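import Summits.QuantumFields.BalabanUV.Beta.ChartConjugationRelative

/-!
# `BalabanUV.Beta.HessKerTwoLevelSplit` — binder row D1, LAYER-2 SKELETON AT THE HESSIAN LEVEL: the one-loop kernel `½·tadpole − ½·bubble`
# of a resolvent that SPLITS as `G′ = G + Hᵗ∘C∘H (+ N)` is the kernel of `G` plus the kernel of `C` over the PULLED-BACK jets
# `Ṽ = H∘V∘Hᵗ`, `W̃ = H∘W∘Hᵗ − H∘V∘G∘V′∘Hᵗ − H∘V′∘G∘V∘Hᵗ` (+ explicit tadpoles∕bubble of the defect `N`)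
# (β sub-cell, BINDER-OWNERS row D1 OWNER, lineage an2 gen 22; generic trace algebra in an5's tame calculus)

HONEST FRAMING (cell charter, verbatim): «discharging BetaPertH makes Balaban's UV stability UNCONDITIONAL — a real
constructive-QFT result; it is NOT the continuum limit and NOT the Clay problem.»
HONEST DEPENDENCY: continuum YM on T⁴ ⇐ BetaPertH ∧ nine spine estimates (0/9 proved); BetaPertH ⇐ (D1) ∧ (D4) ∧ CAP+tail;
G-an2-4 gates asym, D1 and NE2/3/4.
ABSOLUTE RULE (cell, verbatim): «No internally-minted statement may enter as a cited fact. Every hypothesis is either kernel-proved in this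
package or a verbatim quotation of a PUBLISHED theorem with page reference. The manuscript(s) under audit are NOT citable for their own
disputed steps — they are the thing under adjudication; programme-internal (2001/route/tribunal) claims are never citable.»
NOTHING below is cited and nothing of Bałaban's operators is asserted: GENERIC kernels `G G′ C H N V W : MKer D F` in the existential classes
`Spr`∕`Loc` of an5's `TameKernelCalculus`; every theorem is [folklore] trace algebra (re-association `comp_assoc_tame`, cyclicity
`tr_comp_comm_loc`, additivity) over absolutely convergent lattice sums.  No `def`, no `Prop`.

WHY (row-D1 owner, gen 22; census `BETA/AN2.md` §50.2).  The remaining telescoping clause of row D1 ((R1) ⟹ (SDF) ⟹ (SDF-Σ), `RowD1Telescoping`∕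
`RowD1TelescopingBounded`) compares one-loop kernels `hessKer A V W = ½·tadpole A W − ½·bubble A V V′` over DIFFERENT resolvents.  The LAYER-2 owners
(an5 `ResolventComposition(StepB)`: K1b′∕K1c⁻∕K1aᵀ; road FP `PerfectTelescopingFinite*`: the (j,m)-resolvent telescoping on TRANSVERSE test forms)
supply RESOLVENT-LEVEL splits `G′ = G + Hᵗ∘C∘H` up to a defect `N` that is visible only off the transverse slice.  This file is the bridge from a
resolvent-level split to the HESSIAN level, once and for all and with the defect carried EXPLICITLY: (i) with `N = 0` the one-loop kernel of `G′`
IS the one-loop kernel of `G` (same jets) PLUS the one-loop kernel of `C` over the pulled-back jets — the pulled-back SECOND-order jet acquiring the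
two «second minimiser response» terms `−H∘V∘G∘V′∘Hᵗ − H∘V′∘G∘V∘Hᵗ` (the shape of `SecondOrderResponse.K2OfK`∕`BalabanStepW2.K3OfK` in the recursive
literal's `T2RecAt_succ`); (ii) with `N ≠ 0` the discrepancy is `½·tadpole N W − ½·(tadpole N (V∘A∘V′) + tadpole N (V′∘A∘V) + bubble N V V′)`,
`A := G + Hᵗ∘C∘H` — TADPOLES OF THE DEFECT against second-order-type vertices plus the defect's own bubble: precisely what the support item P6c
«LongitudinalCancellation» must kill (Ward covariance of the jets against a longitudinal `N`).  Nothing here says that any typed resolvent splits.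

WHAT (all [folklore]; hypotheses: `Spr G`, `Spr C`, `Spr H` (hence `Spr (trK H)`), `Spr N`, `Loc` vertices):
* `tadpole_twoLevel` : `tadpole (G + Hᵗ∘C∘H) W = tadpole G W + tadpole C (H∘W∘Hᵗ)`.
* `bubble_twoLevel`  : `bubble (G + Hᵗ∘C∘H) V V′ = bubble G V V′ + tadpole C (H∘(V∘G∘V′)∘Hᵗ) + tadpole C (H∘(V′∘G∘V)∘Hᵗ) + bubble C (H∘V∘Hᵗ) (H∘V′∘Hᵗ)`.
* **`hessEntry_twoLevel`** : `½·tadpole (G+T) W − ½·bubble (G+T) V V′ = (½·tadpole G W − ½·bubble G V V′) + (½·tadpole C W̃ − ½·bubble C Ṽ Ṽ′)` with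
  `T = Hᵗ∘C∘H`, `Ṽ = H∘V∘Hᵗ`, `Ṽ′ = H∘V′∘Hᵗ`, `W̃ = H∘W∘Hᵗ − H∘(V∘G∘V′)∘Hᵗ − H∘(V′∘G∘V)∘Hᵗ`.
* `tadpole_defect`, `bubble_defect`, **`hessEntry_twoLevel_defect`** : the same for `G′ = G + T + N` with the explicit `N`-terms.
* **`hessKer_twoLevel`** ∕ **`hessKer_twoLevel_defect`** : the family form for `ExpKernelCalculus.hessKer` (vertex families `V`, `W` with `Loc` members;
  pulled-back families written out).
Provenance: β sub-cell, unit beta-an2 gen 22, 2026-08-20 (v1); no existing file touched.  NOT D1, NOT `BetaPertH`, NOT continuum, NOT Clay.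
-/

open Finset
open scoped BigOperators
open Literature.MathematicalPhysics.QuantumFieldTheory.Balaban1983to89
open Literature.MathematicalPhysics.QuantumFieldTheory.Balaban1983to89.Beta
open ExpKernelCalculus (MKer comp tr bubble tadpole hessKer)
open Summit.QuantumFields.BalabanUV.Beta.TameKernelCalculus
open Summit.QuantumFields.BalabanUV.Beta.ChartConjugationRelative (spr_comp)

namespace Summit.QuantumFields.BalabanUV.Beta.HessKerTwoLevelSplit

noncomputable section

variable {D : ℕ} {F : Type*} [Fintype F]

/-! ## §1 Tadpole and bubble of a split resolvent `G + Hᵗ∘C∘H` -/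

section Split

variable {G C H : MKer D F}

/-- [folklore] The transport sandwich `Hᵗ∘C∘H` is spread. -/
theorem spr_sandwich (hC : Spr C) (hH : Spr H) : Spr (comp (comp (trK H) C) H) :=
  spr_comp (spr_comp hH.trK hC) hH

/-- [folklore] **TRACE OF THE SANDWICH AGAINST A LOCALISED KERNEL, PULLED BACK**: `tr ((Hᵗ∘C∘H)∘X) = tr (C∘(H∘X∘Hᵗ))` for `Loc X`. -/
theorem tr_sandwich_comp (hC : Spr C) (hH : Spr H) {X : MKer D F} (hX : Loc X) :
    tr (comp (comp (comp (trK H) C) H) X) = tr (comp C (comp (comp H X) (trK H))) := by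
  have hHt : Spr (trK H) := hH.trK
  have hHX : Loc (comp H X) := hH.comp_loc hX
  have hY : Loc (comp C (comp H X)) := hC.comp_loc hHX
  have e1 : comp (comp (comp (trK H) C) H) X = comp (trK H) (comp C (comp H X)) := by
    rw [← comp_assoc_tame (spr_comp hHt hC).tame hH.tame hX.tame, ← comp_assoc_tame hHt.tame hC.tame hHX.tame]
  rw [e1, ← tr_comp_comm_loc hY hHt.tame, ← comp_assoc_tame hC.tame hHX.tame hHt.tame]

/-- [folklore] **TADPOLE OF A SPLIT RESOLVENT**: `tadpole (G + Hᵗ∘C∘H) W = tadpole G W + tadpole C (H∘W∘Hᵗ)`. -/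
theorem tadpole_twoLevel (hG : Spr G) (hC : Spr C) (hH : Spr H) {W : MKer D F} (hW : Loc W) :
    tadpole (G + comp (comp (trK H) C) H) W = tadpole G W + tadpole C (comp (comp H W) (trK H)) := by
  have hT := spr_sandwich hC hH
  unfold ExpKernelCalculus.tadpole
  rw [comp_add_left_tame hG.tame hT.tame hW.tame, tr_add_loc (hG.comp_loc hW) (hT.comp_loc hW), tr_sandwich_comp hC hH hW]

/-- [folklore] The mixed term `tr ((G∘V)∘((Hᵗ∘C∘H)∘V′)) = tadpole C (H∘(V′∘G∘V)∘Hᵗ)`. -/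
theorem tr_mixed_left (hG : Spr G) (hC : Spr C) (hH : Spr H) {V V' : MKer D F} (hV : Loc V) (hV' : Loc V') :
    tr (comp (comp G V) (comp (comp (comp (trK H) C) H) V'))
      = tadpole C (comp (comp H (comp (comp V' G) V)) (trK H)) := by
  have hT := spr_sandwich hC hH
  have hGV : Loc (comp G V) := hG.comp_loc hV
  have hTV' : Loc (comp (comp (comp (trK H) C) H) V') := hT.comp_loc hV'
  have hX : Loc (comp V' (comp G V)) := hV'.comp hGV
  -- cyclicity, then re-association into the sandwich form
  rw [tr_comp_comm_loc hGV hTV'.tame, ← comp_assoc_tame hT.tame hV'.tame hGV.tame]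
  unfold ExpKernelCalculus.tadpole
  rw [tr_sandwich_comp hC hH hX, comp_assoc_tame hV'.tame hG.tame hV.tame]

/-- [folklore] The mixed term `tr (((Hᵗ∘C∘H)∘V)∘(G∘V′)) = tadpole C (H∘(V∘G∘V′)∘Hᵗ)`. -/
theorem tr_mixed_right (hG : Spr G) (hC : Spr C) (hH : Spr H) {V V' : MKer D F} (hV : Loc V) (hV' : Loc V') :
    tr (comp (comp (comp (comp (trK H) C) H) V) (comp G V'))
      = tadpole C (comp (comp H (comp (comp V G) V')) (trK H)) := by
  have hT := spr_sandwich hC hH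
  have hGV' : Loc (comp G V') := hG.comp_loc hV'
  have hX : Loc (comp V (comp G V')) := hV.comp hGV'
  rw [← comp_assoc_tame hT.tame hV.tame hGV'.tame]
  unfold ExpKernelCalculus.tadpole
  rw [tr_sandwich_comp hC hH hX, comp_assoc_tame hV.tame hG.tame hV'.tame]

/-- [folklore] The quadratic term `tr (((Hᵗ∘C∘H)∘V)∘((Hᵗ∘C∘H)∘V′)) = bubble C (H∘V∘Hᵗ) (H∘V′∘Hᵗ)`. -/
theorem tr_quadratic (hC : Spr C) (hH : Spr H) {V V' : MKer D F} (hV : Loc V) (hV' : Loc V') :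
    tr (comp (comp (comp (comp (trK H) C) H) V) (comp (comp (comp (trK H) C) H) V'))
      = bubble C (comp (comp H V) (trK H)) (comp (comp H V') (trK H)) := by
  have hT := spr_sandwich hC hH
  have hHt : Spr (trK H) := hH.trK
  have hTV' : Loc (comp (comp (comp (trK H) C) H) V') := hT.comp_loc hV'
  have hX : Loc (comp V (comp (comp (comp (trK H) C) H) V')) := hV.comp hTV'
  have hHV : Loc (comp H V) := hH.comp_loc hV
  have hHV' : Loc (comp H V') := hH.comp_loc hV'
  have hP : Loc (comp (comp H V) (trK H)) := hHV.comp_spr hHt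
  have hCHV' : Loc (comp C (comp H V')) := hC.comp_loc hHV'
  rw [← comp_assoc_tame hT.tame hV.tame hTV'.tame, tr_sandwich_comp hC hH hX]
  -- inside: H ∘ (V ∘ (T ∘ V′)) ∘ Hᵗ = ((H∘V)∘Hᵗ) ∘ (C ∘ ((H∘V′)∘Hᵗ))
  have e2 : comp (comp H (comp V (comp (comp (comp (trK H) C) H) V'))) (trK H)
      = comp (comp (comp H V) (trK H)) (comp C (comp (comp H V') (trK H))) := by
    rw [comp_assoc_tame hH.tame hV.tame hTV'.tame]
    rw [← comp_assoc_tame (spr_comp hHt hC).tame hH.tame hV'.tame, ← comp_assoc_tame hHt.tame hC.tame hHV'.tame]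
    rw [comp_assoc_tame hHV.tame hHt.tame hCHV'.tame]
    rw [← comp_assoc_tame hP.tame hCHV'.tame hHt.tame, ← comp_assoc_tame hC.tame hHV'.tame hHt.tame]
  rw [e2]
  unfold ExpKernelCalculus.bubble
  rw [comp_assoc_tame hC.tame hP.tame (hC.comp_loc (hHV'.comp_spr hHt)).tame]

/-- [folklore] **BUBBLE OF A SPLIT RESOLVENT**:
`bubble (G + Hᵗ∘C∘H) V V′ = bubble G V V′ + tadpole C (H∘(V∘G∘V′)∘Hᵗ) + tadpole C (H∘(V′∘G∘V)∘Hᵗ) + bubble C (H∘V∘Hᵗ) (H∘V′∘Hᵗ)`. -/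
theorem bubble_twoLevel (hG : Spr G) (hC : Spr C) (hH : Spr H) {V V' : MKer D F} (hV : Loc V) (hV' : Loc V') :
    bubble (G + comp (comp (trK H) C) H) V V'
      = bubble G V V' + tadpole C (comp (comp H (comp (comp V G) V')) (trK H))
          + tadpole C (comp (comp H (comp (comp V' G) V)) (trK H))
          + bubble C (comp (comp H V) (trK H)) (comp (comp H V') (trK H)) := by
  have hT := spr_sandwich hC hH
  have hGV : Loc (comp G V) := hG.comp_loc hV
  have hGV' : Loc (comp G V') := hG.comp_loc hV'
  have hTV : Loc (comp (comp (comp (trK H) C) H) V) := hT.comp_loc hV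
  have hTV' : Loc (comp (comp (comp (trK H) C) H) V') := hT.comp_loc hV'
  unfold ExpKernelCalculus.bubble
  rw [comp_add_left_tame hG.tame hT.tame hV.tame, comp_add_left_tame hG.tame hT.tame hV'.tame,
    comp_add_left_tame hGV.tame hTV.tame (hGV'.add hTV').tame,
    comp_add_right_tame hGV.tame hGV'.tame hTV'.tame, comp_add_right_tame hTV.tame hGV'.tame hTV'.tame,
    tr_add_loc ((hGV.comp hGV').add (hGV.comp hTV')) ((hTV.comp hGV').add (hTV.comp hTV')),
    tr_add_loc (hGV.comp hGV') (hGV.comp hTV'), tr_add_loc (hTV.comp hGV') (hTV.comp hTV'),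
    tr_mixed_left hG hC hH hV hV', tr_mixed_right hG hC hH hV hV', tr_quadratic hC hH hV hV']
  unfold ExpKernelCalculus.bubble ExpKernelCalculus.tadpole
  ring

/-- [folklore] **THE ONE-LOOP KERNEL ENTRY OF A SPLIT RESOLVENT** (`hessKer`'s combination `½·tadpole − ½·bubble`, one entry):
`½·tadpole (G+T) W − ½·bubble (G+T) V V′ = (½·tadpole G W − ½·bubble G V V′) + (½·tadpole C W̃ − ½·bubble C Ṽ Ṽ′)` with `T = Hᵗ∘C∘H`,
`Ṽ = H∘V∘Hᵗ`, `Ṽ′ = H∘V′∘Hᵗ`, `W̃ = H∘W∘Hᵗ − H∘(V∘G∘V′)∘Hᵗ − H∘(V′∘G∘V)∘Hᵗ` — the pulled-back second-order jet carries the two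
«second minimiser response» terms. -/
theorem hessEntry_twoLevel (hG : Spr G) (hC : Spr C) (hH : Spr H) {V V' W : MKer D F} (hV : Loc V) (hV' : Loc V') (hW : Loc W) :
    (1 / 2 : ℝ) * tadpole (G + comp (comp (trK H) C) H) W - (1 / 2 : ℝ) * bubble (G + comp (comp (trK H) C) H) V V'
      = ((1 / 2 : ℝ) * tadpole G W - (1 / 2 : ℝ) * bubble G V V')
        + ((1 / 2 : ℝ) * tadpole C (comp (comp H W) (trK H) - comp (comp H (comp (comp V G) V')) (trK H)
              - comp (comp H (comp (comp V' G) V)) (trK H))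
            - (1 / 2 : ℝ) * bubble C (comp (comp H V) (trK H)) (comp (comp H V') (trK H))) := by
  have hHt : Spr (trK H) := hH.trK
  have hPW : Loc (comp (comp H W) (trK H)) := (hH.comp_loc hW).comp_spr hHt
  have hP1 : Loc (comp (comp H (comp (comp V G) V')) (trK H)) := (hH.comp_loc ((hV.comp_spr hG).comp hV')).comp_spr hHt
  have hP2 : Loc (comp (comp H (comp (comp V' G) V)) (trK H)) := (hH.comp_loc ((hV'.comp_spr hG).comp hV)).comp_spr hHt
  have htad : tadpole C (comp (comp H W) (trK H) - comp (comp H (comp (comp V G) V')) (trK H)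
      - comp (comp H (comp (comp V' G) V)) (trK H))
      = tadpole C (comp (comp H W) (trK H)) - tadpole C (comp (comp H (comp (comp V G) V')) (trK H))
          - tadpole C (comp (comp H (comp (comp V' G) V)) (trK H)) := by
    unfold ExpKernelCalculus.tadpole
    rw [comp_sub_right_tame hC.tame (hPW.sub hP1).tame hP2.tame, comp_sub_right_tame hC.tame hPW.tame hP1.tame,
      tr_sub_loc ((hC.comp_loc hPW).sub (hC.comp_loc hP1)) (hC.comp_loc hP2), tr_sub_loc (hC.comp_loc hPW) (hC.comp_loc hP1)]
  rw [tadpole_twoLevel hG hC hH hW, bubble_twoLevel hG hC hH hV hV', htad]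
  ring

end Split

/-! ## §2 The same with an explicit split defect `N` -/

section Defect

variable {G G' C H N : MKer D F}

/-- [folklore] **TADPOLE WITH A DEFECT**: if `G′ = G + Hᵗ∘C∘H + N` then `tadpole G′ W = tadpole G W + tadpole C (H∘W∘Hᵗ) + tadpole N W`. -/
theorem tadpole_defect (hG : Spr G) (hC : Spr C) (hH : Spr H) (hN : Spr N) (hsplit : G' = G + comp (comp (trK H) C) H + N)
    {W : MKer D F} (hW : Loc W) :
    tadpole G' W = tadpole G W + tadpole C (comp (comp H W) (trK H)) + tadpole N W := by
  have hT := spr_sandwich hC hH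
  have hA : Spr (G + comp (comp (trK H) C) H) := by
    obtain ⟨C₁, δ₁, hδ₁, h₁⟩ := hG
    obtain ⟨C₂, δ₂, hδ₂, h₂⟩ := hT
    refine ⟨|C₁| + |C₂|, min δ₁ δ₂, lt_min hδ₁ hδ₂, fun x y a b => ?_⟩
    have e1 := decays_of_le h₁ (min_le_left δ₁ δ₂) x y a b
    have e2 := decays_of_le h₂ (min_le_right δ₁ δ₂) x y a b
    calc |(G + comp (comp (trK H) C) H) x y a b| ≤ |G x y a b| + |comp (comp (trK H) C) H x y a b| := abs_add_le _ _
      _ ≤ _ := by rw [add_mul]; exact add_le_add e1 e2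
  rw [hsplit]
  unfold ExpKernelCalculus.tadpole
  rw [comp_add_left_tame hA.tame hN.tame hW.tame, tr_add_loc (hA.comp_loc hW) (hN.comp_loc hW)]
  have h := tadpole_twoLevel hG hC hH hW
  unfold ExpKernelCalculus.tadpole at h
  rw [h]

/-- [folklore] **BUBBLE WITH A DEFECT**: if `G′ = A + N`, `A := G + Hᵗ∘C∘H`, then
`bubble G′ V V′ = bubble A V V′ + tadpole N (V∘A∘V′) + tadpole N (V′∘A∘V) + bubble N V V′` (then expand `bubble A` by `bubble_twoLevel`). -/
theorem bubble_add_defect {A : MKer D F} (hA : Spr A) (hN : Spr N) {V V' : MKer D F} (hV : Loc V) (hV' : Loc V') :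
    bubble (A + N) V V' = bubble A V V' + tadpole N (comp (comp V A) V') + tadpole N (comp (comp V' A) V) + bubble N V V' := by
  have hAV : Loc (comp A V) := hA.comp_loc hV
  have hAV' : Loc (comp A V') := hA.comp_loc hV'
  have hNV : Loc (comp N V) := hN.comp_loc hV
  have hNV' : Loc (comp N V') := hN.comp_loc hV'
  -- the two mixed traces as tadpoles of N
  have m1 : tr (comp (comp A V) (comp N V')) = tadpole N (comp (comp V' A) V) := by
    unfold ExpKernelCalculus.tadpole
    rw [tr_comp_comm_loc hAV hNV'.tame, ← comp_assoc_tame hN.tame hV'.tame hAV.tame, comp_assoc_tame hV'.tame hA.tame hV.tame]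
  have m2 : tr (comp (comp N V) (comp A V')) = tadpole N (comp (comp V A) V') := by
    unfold ExpKernelCalculus.tadpole
    rw [← comp_assoc_tame hN.tame hV.tame hAV'.tame, comp_assoc_tame hV.tame hA.tame hV'.tame]
  unfold ExpKernelCalculus.bubble
  rw [comp_add_left_tame hA.tame hN.tame hV.tame, comp_add_left_tame hA.tame hN.tame hV'.tame,
    comp_add_left_tame hAV.tame hNV.tame (hAV'.add hNV').tame,
    comp_add_right_tame hAV.tame hAV'.tame hNV'.tame, comp_add_right_tame hNV.tame hAV'.tame hNV'.tame,
    tr_add_loc ((hAV.comp hAV').add (hAV.comp hNV')) ((hNV.comp hAV').add (hNV.comp hNV')),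
    tr_add_loc (hAV.comp hAV') (hAV.comp hNV'), tr_add_loc (hNV.comp hAV') (hNV.comp hNV'), m1, m2]
  ring

/-- [folklore] **THE ONE-LOOP KERNEL ENTRY WITH A SPLIT DEFECT**: for `G′ = G + T + N`, `T = Hᵗ∘C∘H`, `A = G + T`,
`½·tadpole G′ W − ½·bubble G′ V V′ = (½·tadpole G W − ½·bubble G V V′) + (½·tadpole C W̃ − ½·bubble C Ṽ Ṽ′) + R_N` with the EXPLICIT defect
remainder `R_N = ½·tadpole N W − ½·(tadpole N (V∘A∘V′) + tadpole N (V′∘A∘V) + bubble N V V′)` — tadpoles of the defect against second-order-type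
vertices plus the defect's bubble: what P6c «LongitudinalCancellation» has to kill. -/
theorem hessEntry_twoLevel_defect (hG : Spr G) (hC : Spr C) (hH : Spr H) (hN : Spr N)
    (hsplit : G' = G + comp (comp (trK H) C) H + N) {V V' W : MKer D F} (hV : Loc V) (hV' : Loc V') (hW : Loc W) :
    (1 / 2 : ℝ) * tadpole G' W - (1 / 2 : ℝ) * bubble G' V V'
      = ((1 / 2 : ℝ) * tadpole G W - (1 / 2 : ℝ) * bubble G V V')
        + ((1 / 2 : ℝ) * tadpole C (comp (comp H W) (trK H) - comp (comp H (comp (comp V G) V')) (trK H)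
              - comp (comp H (comp (comp V' G) V)) (trK H))
            - (1 / 2 : ℝ) * bubble C (comp (comp H V) (trK H)) (comp (comp H V') (trK H)))
        + ((1 / 2 : ℝ) * tadpole N W
            - (1 / 2 : ℝ) * (tadpole N (comp (comp V (G + comp (comp (trK H) C) H)) V')
                + tadpole N (comp (comp V' (G + comp (comp (trK H) C) H)) V) + bubble N V V')) := by
  have hT := spr_sandwich hC hH
  have hA : Spr (G + comp (comp (trK H) C) H) := by
    obtain ⟨C₁, δ₁, hδ₁, h₁⟩ := hG
    obtain ⟨C₂, δ₂, hδ₂, h₂⟩ := hT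
    refine ⟨|C₁| + |C₂|, min δ₁ δ₂, lt_min hδ₁ hδ₂, fun x y a b => ?_⟩
    have e1 := decays_of_le h₁ (min_le_left δ₁ δ₂) x y a b
    have e2 := decays_of_le h₂ (min_le_right δ₁ δ₂) x y a b
    calc |(G + comp (comp (trK H) C) H) x y a b| ≤ |G x y a b| + |comp (comp (trK H) C) H x y a b| := abs_add_le _ _
      _ ≤ _ := by rw [add_mul]; exact add_le_add e1 e2
  have hb : bubble G' V V' = bubble (G + comp (comp (trK H) C) H) V V'
      + tadpole N (comp (comp V (G + comp (comp (trK H) C) H)) V')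
      + tadpole N (comp (comp V' (G + comp (comp (trK H) C) H)) V) + bubble N V V' := by
    rw [hsplit]; exact bubble_add_defect hA hN hV hV'
  have ht : tadpole G' W = tadpole (G + comp (comp (trK H) C) H) W + tadpole N W := by
    rw [tadpole_defect hG hC hH hN hsplit hW, tadpole_twoLevel hG hC hH hW]
  rw [hb, ht, ← hessEntry_twoLevel hG hC hH hV hV' hW]
  ring

end Defect

/-! ## §3 The family form for `ExpKernelCalculus.hessKer` -/

section Family

variable {G G' C H N : MKer D F}
  {V : Fin D → (Fin D → ℤ) → MKer D F} {W : Fin D → (Fin D → ℤ) → Fin D → (Fin D → ℤ) → MKer D F}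

/-- [folklore] **ONE-LOOP KERNEL OF A SPLIT RESOLVENT, FAMILY FORM**: for vertex families with `Loc` members and `G′ := G + Hᵗ∘C∘H`,
`hessKer (G + Hᵗ∘C∘H) V W μ ν z = hessKer G V W μ ν z + hessKer C Ṽ W̃ μ ν z` with the pulled-back families
`Ṽ μ y := H∘V μ y∘Hᵗ`, `W̃ μ y ν y′ := H∘W μ y ν y′∘Hᵗ − H∘(V μ y∘G∘V ν y′)∘Hᵗ − H∘(V ν y′∘G∘V μ y)∘Hᵗ`. -/
theorem hessKer_twoLevel (hG : Spr G) (hC : Spr C) (hH : Spr H) (hV : ∀ μ y, Loc (V μ y)) (hW : ∀ μ y ν y', Loc (W μ y ν y'))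
    (μ ν : Fin D) (z : Fin D → ℤ) :
    hessKer (G + comp (comp (trK H) C) H) V W μ ν z
      = hessKer G V W μ ν z
        + hessKer C (fun μ' y => comp (comp H (V μ' y)) (trK H))
            (fun μ' y ν' y' => comp (comp H (W μ' y ν' y')) (trK H) - comp (comp H (comp (comp (V μ' y) G) (V ν' y'))) (trK H)
              - comp (comp H (comp (comp (V ν' y') G) (V μ' y))) (trK H)) μ ν z := by
  unfold ExpKernelCalculus.hessKer
  exact hessEntry_twoLevel hG hC hH (hV μ 0) (hV ν z) (hW μ 0 ν z)

/-- [folklore] **ONE-LOOP KERNEL WITH A SPLIT DEFECT, FAMILY FORM**: for `G′ = G + Hᵗ∘C∘H + N`,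
`hessKer G′ V W μ ν z = hessKer G V W μ ν z + hessKer C Ṽ W̃ μ ν z + R_N μ ν z` with
`R_N μ ν z = ½·tadpole N (W μ 0 ν z) − ½·(tadpole N (V μ 0∘A∘V ν z) + tadpole N (V ν z∘A∘V μ 0) + bubble N (V μ 0) (V ν z))`, `A = G + Hᵗ∘C∘H`. -/
theorem hessKer_twoLevel_defect (hG : Spr G) (hC : Spr C) (hH : Spr H) (hN : Spr N)
    (hsplit : G' = G + comp (comp (trK H) C) H + N) (hV : ∀ μ y, Loc (V μ y)) (hW : ∀ μ y ν y', Loc (W μ y ν y'))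
    (μ ν : Fin D) (z : Fin D → ℤ) :
    hessKer G' V W μ ν z
      = hessKer G V W μ ν z
        + hessKer C (fun μ' y => comp (comp H (V μ' y)) (trK H))
            (fun μ' y ν' y' => comp (comp H (W μ' y ν' y')) (trK H) - comp (comp H (comp (comp (V μ' y) G) (V ν' y'))) (trK H)
              - comp (comp H (comp (comp (V ν' y') G) (V μ' y))) (trK H)) μ ν z
        + ((1 / 2 : ℝ) * tadpole N (W μ 0 ν z)
            - (1 / 2 : ℝ) * (tadpole N (comp (comp (V μ 0) (G + comp (comp (trK H) C) H)) (V ν z))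
                + tadpole N (comp (comp (V ν z) (G + comp (comp (trK H) C) H)) (V μ 0)) + bubble N (V μ 0) (V ν z))) := by
  unfold ExpKernelCalculus.hessKer
  exact hessEntry_twoLevel_defect hG hC hH hN hsplit (hV μ 0) (hV ν z) (hW μ 0 ν z)

end Family

end

end Summit.QuantumFields.BalabanUV.Beta.HessKerTwoLevelSplit
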